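/-
Copyright (c) 2026 the pub-hodgecm-mathlib formalisation cell (harness21).  Prover seat hodgecm-mathlib-K2Liu-p11 (g0), Track B «K2-LIT»,
#184♮ = hLiu418 = `stmt-HodgeConjecture-24832`; LEAD F0P6-plan (g13) RULING M-157d (4) «p11 keeps the compact-picture letters» +
K2Liu-p05 (g4) (SD-1-ind) heads (II).  File: the STABILISER of `i·1` in `U(J)` block-wise, and its Cayley components in `U(l) × U(l)`.
THEOREMS ONLY.
-/
import Summits.HodgeConjecture.HodgeConjecture.Theorems.K2LiuHermitianTubeDescend   -- ★ (this seat) H1-C: `inv_mem_UJ`, `moeb_inv_mul_I`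
import HarnessLib

/-!
# Crux `HLiu418`, compact-picture letters: `Stab_{U(J)}(i1) = {(a b; −b a)}`, Cayley components `a ± ib ∈ U(l)`, `j(u,i1) = a − ib`

Cell `hodgecm-mathlib`, crux item hLiu418 = `stmt-HodgeConjecture-24832` (helper lane `--supports`, count-neutral).

For `u = (A B; C D) ∈ U(J)` (`uᴴ J u = J`, `J = (0 −1; 1 0)`) fixing the base point `i·1` of the Hermitian tube:
* §1 `fromBlocks_inv_eq` ∕ `inv_eq_fromBlocks` — `u⁻¹ = (Dᴴ −Bᴴ; −Cᴴ Aᴴ)` (from the block relations ★ `blocks_rel`);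
* §2 `toBlocks_of_stab` — `C = −B` and `D = A` (the stabiliser equation ★ `moeb_I_eq_I_iff` for `u` AND for `u⁻¹`);
  `eq_fromBlocks_of_stab` — `u = (A B; −B A)`; `blocks_rel_of_stab` — `AᴴA + BᴴB = 1`, `AᴴB = BᴴA`;
* §3 `cayley_mem_unitaryGroup` — `A + iB, A − iB ∈ Matrix.unitaryGroup l ℂ` (the isomorphism `Stab(i1) ≅ U(l) × U(l)` on objects; the
  converse direction is ★ `rotation_mem_and_moeb_I`); `denom_I_of_stab` — `j(u, i1) = A − iB`, so the scalar `K_w`-type `j(u,i1)^{−k}` is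
  `det(A − iB)^{−k}` = the character `det(k₂)^{−k}` of the second Cayley factor (p05's ★ `vac_archWeilSectionS_placeSecJ_kV` at `k = 1`);
* §4 (appended) `moeb_I_eq_I_iff_mem_unitaryGroup` — `Stab_{U(J)}(i1) = U(J) ∩ U(2l)`; `cayley_fst_mul`/`cayley_snd_mul`/`cayley_one`/
  `eq_of_cayley_eq` — the Cayley map `u ↦ (A + iB, A − iB)` is a multiplicative injection into `U(l) × U(l)`;
* §5 (appended) `exists_stab_of_mem_unitaryGroup` — … and ONTO: `Stab_{U(J)}(i1) ≅ U(l) × U(l)`.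
These are the letters by which an abstract `K_w`-finite vector of `I_w(s)` is READ in the compact picture `U(l) × U(l)` (★ p05 F2
`exists_mvPolynomial_of_finiteDimensional_span_rightTranslates`) and EVALUATED in the tube (★ (D∞)/(A∞-0b)).
References: [Shimura1997, §6.5] (derived, not cited).
HONEST LABEL: HC_CM is proved only modulo the 7 printed citations (2 remaining named inputs: hLiu418 = stmt-HodgeConjecture-24832,
h413 = stmt-HodgeConjecture-24833) until rung 0 closes; count-neutral helper, closes no socket.
-/

set_option autoImplicit false
set_option linter.dupNamespace false

noncomputable section

open Complex Matrix
open scoped ComplexOrder ComplexConjugate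

namespace Summit.HodgeConjecture.HodgeConjecture.Cruxes.HLiu418.K2LiuSiegelStabBlocks

open Literature.NumberTheory.ModularForms.SiegelUpperHalfSpace (num denom moeb num_def denom_def moeb_def moeb_one)
open Summit.HodgeConjecture.HodgeConjecture.Cruxes.HLiu418.K2LiuHermitianTubeCocycle
open Summit.HodgeConjecture.HodgeConjecture.Cruxes.HLiu418.K2LiuHermitianTubeAction
open Summit.HodgeConjecture.HodgeConjecture.Cruxes.HLiu418.K2LiuHermitianTubeDescend

variable {l : Type*} [Fintype l] [DecidableEq l]

/-! ## §1  The inverse of an element of `U(J)` -/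

/-- `(A B; C D)⁻¹ = (Dᴴ −Bᴴ; −Cᴴ Aᴴ)` in `U(J)` (`u⁻¹ = J⁻¹uᴴJ`). [Shimura1997, §5.1] -/
theorem fromBlocks_inv_eq {A B C D : Matrix l l ℂ} (hu : (fromBlocks A B C D)ᴴ * Matrix.J l ℂ * fromBlocks A B C D = Matrix.J l ℂ) :
    (fromBlocks A B C D)⁻¹ = fromBlocks Dᴴ (-Bᴴ) (-Cᴴ) Aᴴ := by
  obtain ⟨h1, h2, h3, h4⟩ := (fromBlocks_conjTranspose_mul_J_mul_eq_iff A B C D).1 hu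
  apply inv_eq_left_inv
  rw [fromBlocks_multiply, ← fromBlocks_one, fromBlocks_inj]
  refine ⟨?_, ?_, ?_, ?_⟩
  · rw [Matrix.neg_mul, ← sub_eq_add_neg]
    exact h4
  · rw [Matrix.neg_mul, ← sub_eq_add_neg, h2, sub_self]
  · rw [Matrix.neg_mul, h1, neg_add_cancel]
  · rw [Matrix.neg_mul, neg_add_eq_sub]
    exact h3

/-- `u⁻¹ = (Dᴴ −Bᴴ; −Cᴴ Aᴴ)` for `u = (A B; C D) ∈ U(J)`. [Shimura1997, §5.1] -/
theorem inv_eq_fromBlocks {u : Matrix (l ⊕ l) (l ⊕ l) ℂ} (hu : uᴴ * Matrix.J l ℂ * u = Matrix.J l ℂ) :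
    u⁻¹ = fromBlocks u.toBlocks₂₂ᴴ (-u.toBlocks₁₂ᴴ) (-u.toBlocks₂₁ᴴ) u.toBlocks₁₁ᴴ := by
  have hu' := hu
  rw [← fromBlocks_toBlocks u] at hu'
  conv_lhs => rw [← fromBlocks_toBlocks u]
  exact fromBlocks_inv_eq hu'

/-! ## §2  The stabiliser of `i·1` -/

/-- **`Stab_{U(J)}(i1) = {(A B; −B A)}`**: for `u ∈ U(J)` with `u·(i1) = i1`, `C = −B` and `D = A`. [Shimura1997, §6.5] -/
theorem toBlocks_of_stab {u : Matrix (l ⊕ l) (l ⊕ l) ℂ} (hu : uᴴ * Matrix.J l ℂ * u = Matrix.J l ℂ)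
    (hI : moeb u (I • (1 : Matrix l l ℂ)) = I • 1) :
    u.toBlocks₂₁ = -u.toBlocks₁₂ ∧ u.toBlocks₂₂ = u.toBlocks₁₁ := by
  -- the stabiliser equation for `u`
  have e1 := (moeb_I_eq_I_iff hu).1 hI
  -- … and for `u⁻¹`
  have h1 : (1 : Matrix (l ⊕ l) (l ⊕ l) ℂ)ᴴ * Matrix.J l ℂ * 1 = Matrix.J l ℂ := by
    rw [conjTranspose_one, Matrix.one_mul, Matrix.mul_one]
  have hinvI : moeb u⁻¹ (I • (1 : Matrix l l ℂ)) = I • 1 := by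
    have h := moeb_inv_mul_I h1 hu (by rw [moeb_one, hI])
    rw [Matrix.mul_one] at h
    exact h
  have e2 := (moeb_I_eq_I_iff (inv_mem_UJ hu)).1 hinvI
  rw [inv_eq_fromBlocks hu, toBlocks_fromBlocks₁₁, toBlocks_fromBlocks₁₂, toBlocks_fromBlocks₂₁, toBlocks_fromBlocks₂₂, neg_neg] at e2
  -- conjugate-transpose the second equation
  have e3 := congrArg conjTranspose e2
  rw [conjTranspose_add, conjTranspose_add, conjTranspose_smul, conjTranspose_smul, conjTranspose_neg, conjTranspose_conjTranspose,
    conjTranspose_conjTranspose, conjTranspose_conjTranspose, conjTranspose_conjTranspose, Complex.star_def, conj_I, neg_smul,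
    neg_smul] at e3
  -- `B + C = i(D − A)` and `B + C = −i(D − A)`
  have hsum : u.toBlocks₁₂ + u.toBlocks₂₁ = 0 := by
    have ha : u.toBlocks₁₂ + u.toBlocks₂₁ = I • u.toBlocks₂₂ - I • u.toBlocks₁₁ := by
      rw [eq_sub_iff_add_eq]
      calc u.toBlocks₁₂ + u.toBlocks₂₁ + I • u.toBlocks₁₁ = (I • u.toBlocks₁₁ + u.toBlocks₁₂) + u.toBlocks₂₁ := by abel
        _ = (-u.toBlocks₂₁ + I • u.toBlocks₂₂) + u.toBlocks₂₁ := by rw [e1]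
        _ = I • u.toBlocks₂₂ := by abel
    have hb : u.toBlocks₁₂ + u.toBlocks₂₁ = -(I • u.toBlocks₂₂ - I • u.toBlocks₁₁) := by
      rw [neg_sub, eq_sub_iff_add_eq]
      calc u.toBlocks₁₂ + u.toBlocks₂₁ + I • u.toBlocks₂₂ = -(-(I • u.toBlocks₂₂) + -u.toBlocks₁₂) + u.toBlocks₂₁ := by abel
        _ = -(u.toBlocks₂₁ + -(I • u.toBlocks₁₁)) + u.toBlocks₂₁ := by rw [e3]
        _ = I • u.toBlocks₁₁ := by abel
    have h2 : (2 : ℂ) • (u.toBlocks₁₂ + u.toBlocks₂₁) = 0 := by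
      rw [two_smul]
      nth_rewrite 1 [ha]
      rw [hb, add_neg_cancel]
    exact (smul_eq_zero.1 h2).resolve_left two_ne_zero
  have hC : u.toBlocks₂₁ = -u.toBlocks₁₂ := by
    rw [← add_eq_zero_iff_neg_eq.1 hsum]
  refine ⟨hC, ?_⟩
  -- then `i(A − D) = 0`
  have hAD : I • u.toBlocks₁₁ = I • u.toBlocks₂₂ := by
    have h := e1
    rw [hC, neg_neg] at h
    exact add_right_cancel (h.trans (add_comm _ _))
  exact ((smul_right_injective (Matrix l l ℂ) I_ne_zero) hAD).symm

/-- `u = (A B; −B A)` for `u ∈ Stab_{U(J)}(i1)`. [Shimura1997, §6.5] -/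
theorem eq_fromBlocks_of_stab {u : Matrix (l ⊕ l) (l ⊕ l) ℂ} (hu : uᴴ * Matrix.J l ℂ * u = Matrix.J l ℂ)
    (hI : moeb u (I • (1 : Matrix l l ℂ)) = I • 1) :
    u = fromBlocks u.toBlocks₁₁ u.toBlocks₁₂ (-u.toBlocks₁₂) u.toBlocks₁₁ := by
  obtain ⟨hC, hD⟩ := toBlocks_of_stab hu hI
  conv_lhs => rw [← fromBlocks_toBlocks u, hC, hD]

/-- The block relations on the stabiliser: `AᴴA + BᴴB = 1` and `AᴴB = BᴴA`. [Shimura1997, §6.5] -/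
theorem blocks_rel_of_stab {u : Matrix (l ⊕ l) (l ⊕ l) ℂ} (hu : uᴴ * Matrix.J l ℂ * u = Matrix.J l ℂ)
    (hI : moeb u (I • (1 : Matrix l l ℂ)) = I • 1) :
    u.toBlocks₁₁ᴴ * u.toBlocks₁₁ + u.toBlocks₁₂ᴴ * u.toBlocks₁₂ = 1 ∧ u.toBlocks₁₁ᴴ * u.toBlocks₁₂ = u.toBlocks₁₂ᴴ * u.toBlocks₁₁ := by
  obtain ⟨hC, hD⟩ := toBlocks_of_stab hu hI
  obtain ⟨h1, -, h3, -⟩ := blocks_rel hu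
  rw [hC] at h1 h3
  rw [hD, conjTranspose_neg, Matrix.neg_mul, sub_neg_eq_add] at h3
  rw [Matrix.mul_neg, conjTranspose_neg, Matrix.neg_mul] at h1
  exact ⟨h3, neg_injective h1⟩

/-! ## §3  Cayley components and the automorphy matrix -/

/-- **CAYLEY COMPONENTS**: for `u = (A B; −B A) ∈ Stab_{U(J)}(i1)`, both `A + iB` and `A − iB` are unitary
(`(A ∓ iB)ᴴ(A ∓ iB) = AᴴA + BᴴB ± i(BᴴA − AᴴB) = 1`). [Shimura1997, §6.5] -/
theorem cayley_mem_unitaryGroup {u : Matrix (l ⊕ l) (l ⊕ l) ℂ} (hu : uᴴ * Matrix.J l ℂ * u = Matrix.J l ℂ)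
    (hI : moeb u (I • (1 : Matrix l l ℂ)) = I • 1) :
    u.toBlocks₁₁ + I • u.toBlocks₁₂ ∈ Matrix.unitaryGroup l ℂ ∧ u.toBlocks₁₁ - I • u.toBlocks₁₂ ∈ Matrix.unitaryGroup l ℂ := by
  obtain ⟨h1, h2⟩ := blocks_rel_of_stab hu hI
  have hsI : (star I : ℂ) = -I := by rw [Complex.star_def, conj_I]
  have hII : (star I : ℂ) * I = 1 := by rw [hsI, neg_mul, I_mul_I, neg_neg]
  constructor
  · rw [Matrix.mem_unitaryGroup_iff', star_eq_conjTranspose, conjTranspose_add, conjTranspose_smul, Matrix.add_mul, Matrix.mul_add,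
      Matrix.mul_add, Matrix.smul_mul, Matrix.mul_smul, Matrix.smul_mul, Matrix.mul_smul, smul_smul, hII, one_smul, h2, hsI, neg_smul]
    calc u.toBlocks₁₁ᴴ * u.toBlocks₁₁ + I • (u.toBlocks₁₂ᴴ * u.toBlocks₁₁) +
          (-(I • (u.toBlocks₁₂ᴴ * u.toBlocks₁₁)) + u.toBlocks₁₂ᴴ * u.toBlocks₁₂)
        = u.toBlocks₁₁ᴴ * u.toBlocks₁₁ + u.toBlocks₁₂ᴴ * u.toBlocks₁₂ := by abel
      _ = 1 := h1
  · rw [Matrix.mem_unitaryGroup_iff', star_eq_conjTranspose, conjTranspose_sub, conjTranspose_smul, Matrix.sub_mul, Matrix.mul_sub,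
      Matrix.mul_sub, Matrix.smul_mul, Matrix.mul_smul, Matrix.smul_mul, Matrix.mul_smul, smul_smul, hII, one_smul, h2, hsI, neg_smul]
    calc u.toBlocks₁₁ᴴ * u.toBlocks₁₁ - I • (u.toBlocks₁₂ᴴ * u.toBlocks₁₁) -
          (-(I • (u.toBlocks₁₂ᴴ * u.toBlocks₁₁)) - u.toBlocks₁₂ᴴ * u.toBlocks₁₂)
        = u.toBlocks₁₁ᴴ * u.toBlocks₁₁ + u.toBlocks₁₂ᴴ * u.toBlocks₁₂ := by abel
      _ = 1 := h1

/-- **THE AUTOMORPHY MATRIX ON THE STABILISER**: `j(u, i1) = iC + D = A − iB` — the second Cayley component; hence the scalar `K_w`-type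
`j(u,i1)^{−k} = det(A − iB)^{−k}`. [Shimura1997, §6.5] -/
theorem denom_I_of_stab {u : Matrix (l ⊕ l) (l ⊕ l) ℂ} (hu : uᴴ * Matrix.J l ℂ * u = Matrix.J l ℂ)
    (hI : moeb u (I • (1 : Matrix l l ℂ)) = I • 1) :
    denom u (I • (1 : Matrix l l ℂ)) = u.toBlocks₁₁ - I • u.toBlocks₁₂ := by
  obtain ⟨hC, hD⟩ := toBlocks_of_stab hu hI
  rw [denom_I, hC, hD, smul_neg, neg_add_eq_sub]

/-- `det j(u, i1) = det(A − iB)` on the stabiliser. [Shimura1997, §6.5] -/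
theorem det_denom_I_of_stab {u : Matrix (l ⊕ l) (l ⊕ l) ℂ} (hu : uᴴ * Matrix.J l ℂ * u = Matrix.J l ℂ)
    (hI : moeb u (I • (1 : Matrix l l ℂ)) = I • 1) :
    (denom u (I • (1 : Matrix l l ℂ))).det = (u.toBlocks₁₁ - I • u.toBlocks₁₂).det := by
  rw [denom_I_of_stab hu hI]

-- `‖det j(u, i1)‖ = 1` on the stabiliser is ★ `K2LiuArchInducedTubeSectionPrelims.norm_det_denom_of_stab`.

/-! ## §4  `Stab_{U(J)}(i1) = U(J) ∩ U(2l)` and the Cayley map is multiplicative (appended) -/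

/-- An element of the stabiliser is a UNITARY matrix: `Stab_{U(J)}(i1) ⊆ U(J) ∩ unitaryGroup (l ⊕ l) ℂ`
(`(A B; −B A)ᴴ(A B; −B A) = 1` from `AᴴA + BᴴB = 1`, `AᴴB = BᴴA`). [Shimura1997, §6.5] -/
theorem mem_unitaryGroup_of_stab {u : Matrix (l ⊕ l) (l ⊕ l) ℂ} (hu : uᴴ * Matrix.J l ℂ * u = Matrix.J l ℂ)
    (hI : moeb u (I • (1 : Matrix l l ℂ)) = I • 1) : u ∈ Matrix.unitaryGroup (l ⊕ l) ℂ := by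
  obtain ⟨h1, h2⟩ := blocks_rel_of_stab hu hI
  rw [Matrix.mem_unitaryGroup_iff', star_eq_conjTranspose]
  have hue := eq_fromBlocks_of_stab hu hI
  rw [hue, fromBlocks_conjTranspose, fromBlocks_multiply, conjTranspose_neg, Matrix.neg_mul, Matrix.neg_mul, Matrix.mul_neg,
    Matrix.mul_neg, neg_neg, ← sub_eq_add_neg, h2, sub_self, ← fromBlocks_one, fromBlocks_inj]
  exact ⟨h1, rfl, by rw [add_neg_cancel], by rw [add_comm, h1]⟩

/-- Conversely, a unitary element of `U(J)` commutes with `J`, hence has the shape `(A B; −B A)` and FIXES `i1`: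
`Stab_{U(J)}(i1) = U(J) ∩ unitaryGroup (l ⊕ l) ℂ`. [Shimura1997, §6.5] -/
theorem moeb_I_eq_I_of_mem_unitaryGroup {u : Matrix (l ⊕ l) (l ⊕ l) ℂ} (hu : uᴴ * Matrix.J l ℂ * u = Matrix.J l ℂ)
    (hU : u ∈ Matrix.unitaryGroup (l ⊕ l) ℂ) : moeb u (I • (1 : Matrix l l ℂ)) = I • 1 := by
  have hUU : u * uᴴ = 1 := by
    have h := Matrix.mem_unitaryGroup_iff.1 hU
    rwa [star_eq_conjTranspose] at h
  have hUU' : uᴴ * u = 1 := by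
    have h := Matrix.mem_unitaryGroup_iff'.1 hU
    rwa [star_eq_conjTranspose] at h
  -- `J u = u J`
  have hcomm : Matrix.J l ℂ * u = u * Matrix.J l ℂ := by
    calc Matrix.J l ℂ * u = (u * uᴴ) * Matrix.J l ℂ * u := by rw [hUU, Matrix.one_mul]
      _ = u * (uᴴ * Matrix.J l ℂ * u) := by simp only [Matrix.mul_assoc]
      _ = u * Matrix.J l ℂ := by rw [hu]
  -- blocks: `C = −B`, `D = A`
  obtain ⟨A, B, C, D, rfl⟩ : ∃ A B C D : Matrix l l ℂ, u = fromBlocks A B C D := ⟨_, _, _, _, (fromBlocks_toBlocks u).symm⟩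
  rw [Matrix.J, fromBlocks_multiply, fromBlocks_multiply] at hcomm
  simp only [Matrix.zero_mul, Matrix.mul_zero, Matrix.one_mul, Matrix.mul_one, Matrix.neg_mul, Matrix.mul_neg, zero_add, add_zero,
    fromBlocks_inj] at hcomm
  obtain ⟨hC, hD, -, -⟩ := hcomm
  have hC' : C = -B := by rw [← neg_neg C, hC]
  have hD' : D = A := by rw [← neg_neg D, hD, neg_neg]
  subst hC' hD'
  -- the block relations from unitarity
  rw [fromBlocks_conjTranspose, fromBlocks_multiply, conjTranspose_neg, Matrix.neg_mul, Matrix.neg_mul, Matrix.mul_neg, Matrix.mul_neg,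
    neg_neg, ← sub_eq_add_neg, ← fromBlocks_one, fromBlocks_inj] at hUU'
  obtain ⟨h1, h2, -, -⟩ := hUU'
  exact (rotation_mem_and_moeb_I h1 (sub_eq_zero.1 h2)).2

/-- **`Stab_{U(J)}(i1) = U(J) ∩ U(2l)`**: for `u ∈ U(J)`, `u·(i1) = i1 ↔ u` is unitary. [Shimura1997, §6.5] -/
theorem moeb_I_eq_I_iff_mem_unitaryGroup {u : Matrix (l ⊕ l) (l ⊕ l) ℂ} (hu : uᴴ * Matrix.J l ℂ * u = Matrix.J l ℂ) :
    moeb u (I • (1 : Matrix l l ℂ)) = I • 1 ↔ u ∈ Matrix.unitaryGroup (l ⊕ l) ℂ :=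
  ⟨mem_unitaryGroup_of_stab hu, moeb_I_eq_I_of_mem_unitaryGroup hu⟩

/-- **THE CAYLEY MAP IS MULTIPLICATIVE** (first component): for `u, u' ∈ Stab_{U(J)}(i1)`,
`(uu')₁₁ + i(uu')₁₂ = (A + iB)(A' + iB')`. [Shimura1997, §6.5] -/
theorem cayley_fst_mul {u u' : Matrix (l ⊕ l) (l ⊕ l) ℂ} (hu : uᴴ * Matrix.J l ℂ * u = Matrix.J l ℂ)
    (hI : moeb u (I • (1 : Matrix l l ℂ)) = I • 1) (hu' : u'ᴴ * Matrix.J l ℂ * u' = Matrix.J l ℂ)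
    (hI' : moeb u' (I • (1 : Matrix l l ℂ)) = I • 1) :
    (u * u').toBlocks₁₁ + I • (u * u').toBlocks₁₂ =
      (u.toBlocks₁₁ + I • u.toBlocks₁₂) * (u'.toBlocks₁₁ + I • u'.toBlocks₁₂) := by
  have hue := eq_fromBlocks_of_stab hu hI
  have hue' := eq_fromBlocks_of_stab hu' hI'
  obtain ⟨A, hA⟩ : ∃ A, A = u.toBlocks₁₁ := ⟨_, rfl⟩
  obtain ⟨B, hB⟩ : ∃ B, B = u.toBlocks₁₂ := ⟨_, rfl⟩
  obtain ⟨A', hA'⟩ : ∃ A', A' = u'.toBlocks₁₁ := ⟨_, rfl⟩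
  obtain ⟨B', hB'⟩ : ∃ B', B' = u'.toBlocks₁₂ := ⟨_, rfl⟩
  rw [← hA, ← hB] at hue
  rw [← hA', ← hB'] at hue'
  rw [← hA, ← hB, ← hA', ← hB']
  conv_lhs => rw [hue, hue', fromBlocks_multiply, toBlocks_fromBlocks₁₁, toBlocks_fromBlocks₁₂]
  rw [Matrix.add_mul, Matrix.mul_add, Matrix.mul_add, Matrix.smul_mul, Matrix.mul_smul, Matrix.smul_mul, Matrix.mul_smul, smul_smul, I_mul_I,
    neg_one_smul, Matrix.mul_neg, smul_add]
  abel

/-- **THE CAYLEY MAP IS MULTIPLICATIVE** (second component): `(uu')₁₁ − i(uu')₁₂ = (A − iB)(A' − iB')`. [Shimura1997, §6.5] -/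
theorem cayley_snd_mul {u u' : Matrix (l ⊕ l) (l ⊕ l) ℂ} (hu : uᴴ * Matrix.J l ℂ * u = Matrix.J l ℂ)
    (hI : moeb u (I • (1 : Matrix l l ℂ)) = I • 1) (hu' : u'ᴴ * Matrix.J l ℂ * u' = Matrix.J l ℂ)
    (hI' : moeb u' (I • (1 : Matrix l l ℂ)) = I • 1) :
    (u * u').toBlocks₁₁ - I • (u * u').toBlocks₁₂ =
      (u.toBlocks₁₁ - I • u.toBlocks₁₂) * (u'.toBlocks₁₁ - I • u'.toBlocks₁₂) := by
  have hue := eq_fromBlocks_of_stab hu hI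
  have hue' := eq_fromBlocks_of_stab hu' hI'
  obtain ⟨A, hA⟩ : ∃ A, A = u.toBlocks₁₁ := ⟨_, rfl⟩
  obtain ⟨B, hB⟩ : ∃ B, B = u.toBlocks₁₂ := ⟨_, rfl⟩
  obtain ⟨A', hA'⟩ : ∃ A', A' = u'.toBlocks₁₁ := ⟨_, rfl⟩
  obtain ⟨B', hB'⟩ : ∃ B', B' = u'.toBlocks₁₂ := ⟨_, rfl⟩
  rw [← hA, ← hB] at hue
  rw [← hA', ← hB'] at hue'
  rw [← hA, ← hB, ← hA', ← hB']
  conv_lhs => rw [hue, hue', fromBlocks_multiply, toBlocks_fromBlocks₁₁, toBlocks_fromBlocks₁₂]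
  rw [Matrix.sub_mul, Matrix.mul_sub, Matrix.mul_sub, Matrix.smul_mul, Matrix.mul_smul, Matrix.smul_mul, Matrix.mul_smul, smul_smul, I_mul_I,
    neg_one_smul, Matrix.mul_neg, smul_add]
  abel

omit [Fintype l] in
/-- The Cayley components of `1` are `(1, 1)`; with `cayley_fst_mul`/`cayley_snd_mul`/`cayley_mem_unitaryGroup`/`eq_of_cayley_eq` this is
the injective group homomorphism `Stab_{U(J)}(i1) → U(l) × U(l)`, `u ↦ (A + iB, A − iB)`. [Shimura1997, §6.5] -/
theorem cayley_one : ((1 : Matrix (l ⊕ l) (l ⊕ l) ℂ).toBlocks₁₁ + I • (1 : Matrix (l ⊕ l) (l ⊕ l) ℂ).toBlocks₁₂ = 1) ∧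
    ((1 : Matrix (l ⊕ l) (l ⊕ l) ℂ).toBlocks₁₁ - I • (1 : Matrix (l ⊕ l) (l ⊕ l) ℂ).toBlocks₁₂ = 1) := by
  rw [← fromBlocks_one, toBlocks_fromBlocks₁₁, toBlocks_fromBlocks₁₂, smul_zero, add_zero, sub_zero]
  exact ⟨rfl, rfl⟩

/-- The Cayley map is INJECTIVE on the stabiliser (`A = ½(c₁ + c₂)`, `iB = ½(c₁ − c₂)`, `u = (A B; −B A)`). [Shimura1997, §6.5] -/
theorem eq_of_cayley_eq {u u' : Matrix (l ⊕ l) (l ⊕ l) ℂ} (hu : uᴴ * Matrix.J l ℂ * u = Matrix.J l ℂ)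
    (hI : moeb u (I • (1 : Matrix l l ℂ)) = I • 1) (hu' : u'ᴴ * Matrix.J l ℂ * u' = Matrix.J l ℂ)
    (hI' : moeb u' (I • (1 : Matrix l l ℂ)) = I • 1)
    (h₁ : u.toBlocks₁₁ + I • u.toBlocks₁₂ = u'.toBlocks₁₁ + I • u'.toBlocks₁₂)
    (h₂ : u.toBlocks₁₁ - I • u.toBlocks₁₂ = u'.toBlocks₁₁ - I • u'.toBlocks₁₂) : u = u' := by
  have hA : u.toBlocks₁₁ = u'.toBlocks₁₁ := by
    have h : (u.toBlocks₁₁ + I • u.toBlocks₁₂) + (u.toBlocks₁₁ - I • u.toBlocks₁₂) =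
        (u'.toBlocks₁₁ + I • u'.toBlocks₁₂) + (u'.toBlocks₁₁ - I • u'.toBlocks₁₂) := by rw [h₁, h₂]
    rw [add_add_sub_cancel, add_add_sub_cancel, ← two_smul ℂ, ← two_smul ℂ] at h
    exact smul_right_injective (Matrix l l ℂ) (two_ne_zero (α := ℂ)) h
  have hB : u.toBlocks₁₂ = u'.toBlocks₁₂ := by
    have h : (u.toBlocks₁₁ + I • u.toBlocks₁₂) - (u.toBlocks₁₁ - I • u.toBlocks₁₂) =
        (u'.toBlocks₁₁ + I • u'.toBlocks₁₂) - (u'.toBlocks₁₁ - I • u'.toBlocks₁₂) := by rw [h₁, h₂]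
    rw [add_sub_sub_cancel, add_sub_sub_cancel, ← two_smul ℂ, ← two_smul ℂ] at h
    exact smul_right_injective (Matrix l l ℂ) I_ne_zero (smul_right_injective (Matrix l l ℂ) (two_ne_zero (α := ℂ)) h)
  rw [eq_fromBlocks_of_stab hu hI, eq_fromBlocks_of_stab hu' hI', hA, hB]

/-! ## §5  The Cayley map is onto `U(l) × U(l)` (appended) -/

/-- **THE CAYLEY MAP IS ONTO `U(l) × U(l)`**: for unitary `c₁, c₂`, the rotation `u = (A B; −B A)` with `A = ½(c₁ + c₂)`,
`B = −(i/2)(c₁ − c₂)` lies in `Stab_{U(J)}(i1)` and has Cayley components `(c₁, c₂)`. [Shimura1997, §6.5] -/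
theorem exists_stab_of_mem_unitaryGroup {c₁ c₂ : Matrix l l ℂ} (h₁ : c₁ ∈ Matrix.unitaryGroup l ℂ) (h₂ : c₂ ∈ Matrix.unitaryGroup l ℂ) :
    ∃ u : Matrix (l ⊕ l) (l ⊕ l) ℂ, uᴴ * Matrix.J l ℂ * u = Matrix.J l ℂ ∧ moeb u (I • (1 : Matrix l l ℂ)) = I • 1 ∧
      u.toBlocks₁₁ + I • u.toBlocks₁₂ = c₁ ∧ u.toBlocks₁₁ - I • u.toBlocks₁₂ = c₂ := by
  have hc₁ : c₁ᴴ * c₁ = 1 := by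
    have h := Matrix.mem_unitaryGroup_iff'.1 h₁
    rwa [star_eq_conjTranspose] at h
  have hc₂ : c₂ᴴ * c₂ = 1 := by
    have h := Matrix.mem_unitaryGroup_iff'.1 h₂
    rwa [star_eq_conjTranspose] at h
  set A : Matrix l l ℂ := (2 : ℂ)⁻¹ • (c₁ + c₂) with hA
  set B : Matrix l l ℂ := (-(2 : ℂ)⁻¹ * I) • (c₁ - c₂) with hB
  have hs2 : star ((2 : ℂ)⁻¹) = (2 : ℂ)⁻¹ := by
    rw [Complex.star_def, map_inv₀, map_ofNat]
  have hsB : star (-(2 : ℂ)⁻¹ * I) = (2 : ℂ)⁻¹ * I := by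
    rw [Complex.star_def, map_mul, map_neg, map_inv₀, map_ofNat, conj_I, mul_neg, neg_mul, neg_neg]
  have hAH : Aᴴ = (2 : ℂ)⁻¹ • (c₁ᴴ + c₂ᴴ) := by
    rw [hA, conjTranspose_smul, hs2, conjTranspose_add]
  have hBH : Bᴴ = ((2 : ℂ)⁻¹ * I) • (c₁ᴴ - c₂ᴴ) := by
    rw [hB, conjTranspose_smul, hsB, conjTranspose_sub]
  have hrel1 : Aᴴ * A + Bᴴ * B = 1 := by
    rw [hAH, hBH, hA, hB]
    rw [Matrix.smul_mul, Matrix.mul_smul, Matrix.smul_mul, Matrix.mul_smul, smul_smul, smul_smul, Matrix.add_mul, Matrix.mul_add,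
      Matrix.mul_add, Matrix.sub_mul, Matrix.mul_sub, Matrix.mul_sub, hc₁, hc₂]
    have hI2 : (2 : ℂ)⁻¹ * I * (-(2 : ℂ)⁻¹ * I) = (4 : ℂ)⁻¹ := by
      rw [show (2 : ℂ)⁻¹ * I * (-(2 : ℂ)⁻¹ * I) = -((2 : ℂ)⁻¹ * (2 : ℂ)⁻¹) * (I * I) by ring, I_mul_I]
      norm_num
    rw [hI2, show (2 : ℂ)⁻¹ * (2 : ℂ)⁻¹ = (4 : ℂ)⁻¹ by norm_num]
    module
  have hrel2 : Aᴴ * B = Bᴴ * A := by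
    rw [hAH, hBH, hA, hB]
    rw [Matrix.smul_mul, Matrix.mul_smul, Matrix.smul_mul, Matrix.mul_smul, smul_smul, smul_smul, Matrix.add_mul, Matrix.mul_sub,
      Matrix.mul_sub, Matrix.sub_mul, Matrix.mul_add, Matrix.mul_add, hc₁, hc₂]
    module
  refine ⟨fromBlocks A B (-B) A, (rotation_mem_and_moeb_I hrel1 hrel2).1, (rotation_mem_and_moeb_I hrel1 hrel2).2, ?_, ?_⟩
  · rw [toBlocks_fromBlocks₁₁, toBlocks_fromBlocks₁₂, hA, hB, smul_smul, show I * (-(2 : ℂ)⁻¹ * I) = (2 : ℂ)⁻¹ by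
      rw [show I * (-(2 : ℂ)⁻¹ * I) = -(2 : ℂ)⁻¹ * (I * I) by ring, I_mul_I]; ring]
    module
  · rw [toBlocks_fromBlocks₁₁, toBlocks_fromBlocks₁₂, hA, hB, smul_smul, show I * (-(2 : ℂ)⁻¹ * I) = (2 : ℂ)⁻¹ by
      rw [show I * (-(2 : ℂ)⁻¹ * I) = -(2 : ℂ)⁻¹ * (I * I) by ring, I_mul_I]; ring]
    module

end Summit.HodgeConjecture.HodgeConjecture.Cruxes.HLiu418.K2LiuSiegelStabBlocks

end
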